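import Mathlib
import Summits.ValiantsHypothesis.ValiantsHypothesis.Theorems.LacunarySymmetroidMatrixDescartesDetMultiplicityCorank

/-!
# `MatrixDescartes` (stmt-ValiantsHypothesis-18050) — the first-order multiplicity law, KIT: an invertible frame adapted to the
# left kernel, row extraction `C(P)·M = D·N`, and «`N(r)` singular ⇔ a Jordan chain of length two exists»

HONEST FRAMING.  Cell `pub-symmetroid`, seat `val-sym-mdr-p2` (gen 16); helper file `--supports` the crux
`Theses.LacunarySymmetroid.MatrixDescartes`, NO closure claim.  General linear algebra over `ℝ[X]` (any square matrix of
real polynomials, any format) feeding `…DetMultiplicityJordanChain` (the converse half of gen 15's «corank ≤ multiplicity»,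
`Multiplicity.X_sub_C_pow_dvd_det_of_rank`).  Nothing here bears on the crux in its window, on `stub_twoSided`, on
`DoorA26`/`DoorA34`, registers, or `VP ≠ VNP`.

CONTENT.  `M` an `n × n` matrix over `ℝ[X]`, `r : ℝ`, `A = M(r)`, `B = M′(r)`.  (§1) `exists_adapted_rows`: an invertible real
`P` and a set `u` of `#u = corank A` row indices whose rows lie in the LEFT KERNEL of `A` (complete a basis of `ker Aᵀ`);
`linearIndependent_rows_off`: the other rows of `P·A` are independent.  (§2) `exists_row_extraction`: `C(det P)·det M =
(X − r)^{#u}·det N` with `N(r) =` «rows `i ∈ u` of `P·B`, rows `i ∉ u` of `P·A`» (pull `X − r` out of each kernel row;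
`(f/(X−r))(r) = f′(r)`).  (§3) `det_piecewise_ne_zero_of_no_chain` / `det_piecewise_eq_zero_of_chain`: `N(r)` is singular
iff a (left) JORDAN CHAIN OF LENGTH TWO exists — `v ≠ 0`, `v·A = 0`, `w·A + v·B = 0` (Gohberg–Lancaster–Rodman, Matrix
Polynomials, 1982, Ch. 1/7: root functions of order ≥ 2).  [folklore]; axioms standard; no definitions.
-/

-- layout Summits/ValiantsHypothesis/ValiantsHypothesis forces the duplicated namespace component
set_option linter.dupNamespace false

namespace Summit.ValiantsHypothesis.ValiantsHypothesis.Theorems.LacunarySymmetroidMatrixDescartes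

open Polynomial Matrix Finset
open scoped BigOperators

namespace Multiplicity

variable {n : Type} [Fintype n] [DecidableEq n]
/-! ## §1 An invertible frame adapted to the left kernel -/

/-- **Adapted rows.**  For every real square matrix `A` there are an invertible matrix `P` and a set `u` of row indices with
`#u = corank A` such that the rows `P i`, `i ∈ u`, lie in the left kernel of `A` (complete a basis of the left kernel to a
basis of `ℝⁿ`). [folklore] -/
theorem exists_adapted_rows (A : Matrix n n ℝ) :
    ∃ (P : Matrix n n ℝ) (u : Finset n), IsUnit P ∧ (∀ i ∈ u, P i ᵥ* A = 0) ∧ A.rank + u.card = Fintype.card n := by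
  classical
  -- the left kernel of `A` is the kernel of `Aᵀ`
  set W : Submodule ℝ (n → ℝ) := LinearMap.ker (Aᵀ).mulVecLin with hW
  set k : ℕ := Module.finrank ℝ W with hk
  let b : Module.Basis (Fin k) ℝ W := Module.finBasis ℝ W
  let f : Fin k → (n → ℝ) := fun j => (b j : n → ℝ)
  have hf : LinearIndependent ℝ f := (b.linearIndependent.map' W.subtype (Submodule.ker_subtype W))
  have hfinj : Function.Injective f := hf.injective
  set s : Set (n → ℝ) := Set.range f with hs_def
  have hs : LinearIndepOn ℝ id s := hf.linearIndepOn_id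
  -- extend to a basis of `ℝⁿ`
  let T : Set (n → ℝ) := hs.extend (Set.subset_univ s)
  let bT : Module.Basis T ℝ (n → ℝ) := Module.Basis.extend hs
  haveI : Fintype T := FiniteDimensional.fintypeBasisIndex bT
  have hsT : s ⊆ T := Module.Basis.subset_extend hs
  have hcard : Fintype.card T = Fintype.card n := by
    rw [← Module.finrank_eq_card_basis bT, Module.finrank_fintype_fun_eq_card]
  let e : T ≃ n := Fintype.equivOfCardEq hcard
  -- the frame and the kernel rows
  let P : Matrix n n ℝ := fun i => ((e.symm i : T) : n → ℝ)
  let ι' : Fin k → n := fun j => e ⟨f j, hsT ⟨j, rfl⟩⟩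
  have hι' : Function.Injective ι' := by
    intro j j' h
    have h1 := e.injective h
    have h2 : f j = f j' := congrArg (fun t : T => (t : n → ℝ)) h1
    exact hfinj h2
  refine ⟨P, Finset.univ.image ι', ?_, ?_, ?_⟩
  · -- the rows of `P` are a basis
    rw [← Matrix.linearIndependent_rows_iff_isUnit]
    have hrow : (P.row : n → n → ℝ) = (fun t : T => (bT t : n → ℝ)) ∘ e.symm := by
      funext i
      exact (Module.Basis.extend_apply_self hs _).symm
    rw [hrow]
    exact (bT.linearIndependent.comp _ e.symm.injective)
  · -- kernel rows
    intro i hi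
    obtain ⟨j, -, rfl⟩ := Finset.mem_image.1 hi
    have hP : P (ι' j) = f j := by
      simp only [P, ι', Equiv.symm_apply_apply]
    rw [hP]
    have hmem : f j ∈ W := (b j).2
    rw [hW, LinearMap.mem_ker, Matrix.mulVecLin_apply, Matrix.mulVec_transpose] at hmem
    exact hmem
  · -- rank count
    rw [Finset.card_image_of_injective _ hι', Finset.card_univ, Fintype.card_fin]
    have h1 := LinearMap.finrank_range_add_finrank_ker (Aᵀ).mulVecLin
    rw [Module.finrank_fintype_fun_eq_card] at h1
    have h2 : Aᵀ.rank = Module.finrank ℝ (LinearMap.range (Aᵀ).mulVecLin) := rfl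
    rw [Matrix.rank_transpose] at h2
    rw [h2, hk, hW]
    exact h1

/-- With `#u = corank A` kernel rows in an invertible frame `P`, the remaining rows of `P·A` are linearly independent
(they span the row space of `P·A`, which has dimension `rank A = #uᶜ`). [folklore] -/
theorem linearIndependent_rows_off (A P : Matrix n n ℝ) (u : Finset n) (hP : IsUnit P)
    (hu : ∀ i ∈ u, P i ᵥ* A = 0) (hrank : A.rank + u.card = Fintype.card n) :
    LinearIndependent ℝ (fun i : {i // i ∉ u} => (P * A) i) := by
  classical
  rw [linearIndependent_iff_card_eq_finrank_span]
  -- the span of the rows off `u` is the span of all rows (rows in `u` vanish)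
  have hzero : ∀ i ∈ u, (P * A) i = 0 := by
    intro i hi
    have : (P * A) i = P i ᵥ* A := by
      funext j; simp [Matrix.mul_apply, Matrix.vecMul, dotProduct]
    rw [this, hu i hi]
  have hspan : Submodule.span ℝ (Set.range fun i : {i // i ∉ u} => (P * A) i)
      = Submodule.span ℝ (Set.range (P * A).row) := by
    apply le_antisymm
    · exact Submodule.span_mono (by rintro _ ⟨i, rfl⟩; exact ⟨(i : n), rfl⟩)
    · rw [Submodule.span_le]
      rintro _ ⟨i, rfl⟩
      by_cases hi : i ∈ u
      · rw [Matrix.row, hzero i hi]; exact Submodule.zero_mem _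
      · exact Submodule.subset_span ⟨⟨i, hi⟩, rfl⟩
  have hPA : (P * A).rank = A.rank :=
    Matrix.rank_mul_eq_right_of_isUnit_det P A ((Matrix.isUnit_iff_isUnit_det P).1 hP)
  rw [Set.finrank, hspan, ← Matrix.rank_eq_finrank_span_row, hPA, Fintype.card_subtype_compl,
    Fintype.card_coe]
  omega

/-! ## §2 Pulling one factor `X − r` out of each kernel row -/

omit [Fintype n] [DecidableEq n] in
/-- If `f(r) = 0` then `(f / (X − r))(r) = f′(r)`. [folklore] -/
theorem eval_divByMonic_eq_eval_derivative {f : ℝ[X]} {r : ℝ} (hf : f.IsRoot r) :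
    (f /ₘ (X - C r)).eval r = (derivative f).eval r := by
  have h := mul_divByMonic_eq_iff_isRoot.2 hf
  set q := f /ₘ (X - C r) with hq
  have hd : derivative f = q + (X - C r) * derivative q := by
    conv_lhs => rw [← h]
    rw [derivative_mul, derivative_sub, derivative_X, derivative_C, sub_zero, one_mul]
  rw [hd, eval_add, eval_mul, eval_sub, eval_X, eval_C, sub_self, zero_mul, add_zero]

omit [DecidableEq n] in
/-- Entries of `C(P) · M` evaluated at `r`: `(P·M)(r) = P · M(r)`. [folklore] -/
theorem eval_map_C_mul (P : Matrix n n ℝ) (M : Matrix n n ℝ[X]) (r : ℝ) (i j : n) :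
    ((P.map C * M) i j).eval r = (P * M.map (eval r)) i j := by
  simp only [Matrix.mul_apply, Matrix.map_apply, eval_finsetSum, eval_mul, eval_C]

omit [DecidableEq n] in
/-- Entries of `C(P) · M` differentiated and evaluated at `r`: `(P·M)′(r) = P · M′(r)`. [folklore] -/
theorem eval_derivative_map_C_mul (P : Matrix n n ℝ) (M : Matrix n n ℝ[X]) (r : ℝ) (i j : n) :
    (derivative ((P.map C * M) i j)).eval r = (P * (M.map derivative).map (eval r)) i j := by
  simp only [Matrix.mul_apply, Matrix.map_apply, derivative_sum, derivative_C_mul, eval_finsetSum, eval_mul, eval_C]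

/-- **Row extraction.**  If the rows `i ∈ u` of `P · M(r)` vanish, then `C(P)·M = D·N` with `D = diag(X − r on u, 1 off u)`
and `N(r) =` «rows `i ∈ u` of `P·M′(r)`, rows `i ∉ u` of `P·M(r)`»; hence `C(det P)·det M = (X − r)^{#u}·det N`. [folklore] -/
theorem exists_row_extraction (M : Matrix n n ℝ[X]) (r : ℝ) (P : Matrix n n ℝ) (u : Finset n)
    (hu : ∀ i ∈ u, P i ᵥ* M.map (eval r) = 0) :
    ∃ N : Matrix n n ℝ[X], C P.det * M.det = (X - C r) ^ u.card * N.det ∧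
      N.map (eval r) = u.piecewise (P * (M.map derivative).map (eval r)) (P * M.map (eval r)) := by
  classical
  set M₁ : Matrix n n ℝ[X] := P.map C * M with hM₁
  have hroot : ∀ i ∈ u, ∀ j, (M₁ i j).IsRoot r := by
    intro i hi j
    rw [IsRoot, hM₁, eval_map_C_mul]
    have h := congrFun (hu i hi) j
    simpa [Matrix.mul_apply, Matrix.vecMul, dotProduct] using h
  let N : Matrix n n ℝ[X] := fun i j => if i ∈ u then M₁ i j /ₘ (X - C r) else M₁ i j
  have hfac : M₁ = Matrix.diagonal (fun i => if i ∈ u then X - C r else 1) * N := by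
    refine Matrix.ext fun i j => ?_
    rw [Matrix.diagonal_mul]
    by_cases hi : i ∈ u
    · simp only [N, if_pos hi]
      exact (mul_divByMonic_eq_iff_isRoot.2 (hroot i hi j)).symm
    · simp only [N, if_neg hi, one_mul]
  refine ⟨N, ?_, ?_⟩
  · have hdet := congrArg Matrix.det hfac
    rw [hM₁, Matrix.det_mul, Matrix.det_mul, Matrix.det_diagonal] at hdet
    have hP : (P.map C : Matrix n n ℝ[X]).det = C P.det := by
      rw [RingHom.map_det C P]; rfl
    have hprod : (∏ i, (if i ∈ u then (X - C r : ℝ[X]) else 1)) = (X - C r) ^ u.card := by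
      rw [← Finset.prod_mul_prod_compl u, Finset.prod_congr rfl (fun i hi => if_pos hi), Finset.prod_const,
        Finset.prod_eq_one (fun i hi => if_neg (Finset.mem_compl.1 hi)), mul_one]
    rw [hP, hprod] at hdet
    exact hdet
  · ext i j
    rw [Matrix.map_apply]
    by_cases hi : i ∈ u
    · simp only [N, if_pos hi, Finset.piecewise_eq_of_mem _ _ _ hi]
      rw [eval_divByMonic_eq_eval_derivative (hroot i hi j), hM₁, eval_derivative_map_C_mul]
    · simp only [N, if_neg hi, Finset.piecewise_eq_of_notMem _ _ _ hi]
      rw [hM₁, eval_map_C_mul]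

/-! ## §3 `N(r)` is singular iff a Jordan chain of length two exists -/

omit [DecidableEq n] in
/-- A linear combination of rows is a `vecMul`. [folklore] -/
theorem sum_smul_row_eq_vecMul (c : n → ℝ) (Q : Matrix n n ℝ) : ∑ i, c i • Q i = c ᵥ* Q := by
  funext j
  simp [Matrix.vecMul, dotProduct, Finset.sum_apply, Pi.smul_apply, smul_eq_mul]

/-- Combination of the rows of the piecewise matrix: `g · N(r) = (g|ᵤ P)·B + (g|ᵤᶜ P)·A`. [folklore] -/
theorem vecMul_piecewise (A B P : Matrix n n ℝ) (u : Finset n) (g : n → ℝ) :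
    g ᵥ* (u.piecewise (P * B) (P * A) : Matrix n n ℝ)
      = ((fun i => if i ∈ u then g i else 0) ᵥ* P) ᵥ* B + ((fun i => if i ∈ u then 0 else g i) ᵥ* P) ᵥ* A := by
  classical
  rw [Matrix.vecMul_vecMul, Matrix.vecMul_vecMul, ← sum_smul_row_eq_vecMul, ← sum_smul_row_eq_vecMul,
    ← sum_smul_row_eq_vecMul, ← Finset.sum_add_distrib]
  refine Finset.sum_congr rfl fun i _ => ?_
  by_cases hi : i ∈ u
  · rw [Finset.piecewise_eq_of_mem _ _ _ hi, if_pos hi, if_pos hi, zero_smul, add_zero]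
  · rw [Finset.piecewise_eq_of_notMem _ _ _ hi, if_neg hi, if_neg hi, zero_smul, zero_add]

/-- Kernel rows kill `A` in combination: `(g|ᵤ P)·A = 0`. [folklore] -/
theorem vecMul_restrict_kernel (A P : Matrix n n ℝ) (u : Finset n) (hu : ∀ i ∈ u, P i ᵥ* A = 0) (g : n → ℝ) :
    ((fun i => if i ∈ u then g i else 0) ᵥ* P) ᵥ* A = 0 := by
  rw [Matrix.vecMul_vecMul, ← sum_smul_row_eq_vecMul]
  refine Finset.sum_eq_zero fun i _ => ?_
  by_cases hi : i ∈ u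
  · have : (P * A) i = P i ᵥ* A := by
      funext j; simp [Matrix.mul_apply, Matrix.vecMul, dotProduct]
    rw [if_pos hi, this, hu i hi, smul_zero]
  · rw [if_neg hi, zero_smul]

/-- A combination of the rows of `P·A` supported off `u` vanishes only trivially. [folklore] -/
theorem eq_zero_of_vecMul_off (A P : Matrix n n ℝ) (u : Finset n) (hP : IsUnit P)
    (hu : ∀ i ∈ u, P i ᵥ* A = 0) (hrank : A.rank + u.card = Fintype.card n) (g : n → ℝ)
    (hg : ∀ i ∈ u, g i = 0) (h0 : (g ᵥ* P) ᵥ* A = 0) : g = 0 := by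
  classical
  have hli := linearIndependent_rows_off A P u hP hu hrank
  rw [Matrix.vecMul_vecMul, ← sum_smul_row_eq_vecMul] at h0
  -- rewrite the sum over the subtype of indices off `u`
  have h1 : ∑ i, g i • (P * A) i = ∑ i ∈ uᶜ, g i • (P * A) i := by
    rw [← Finset.sum_compl_add_sum u,
      Finset.sum_eq_zero (s := u) (fun i hi => by rw [hg i hi, zero_smul]), add_zero]
  have hsum : ∑ i : {i // i ∉ u}, g (i : n) • (P * A) (i : n) = 0 := by
    rw [← Finset.sum_subtype (uᶜ) (fun i => Finset.mem_compl) (fun i => g i • (P * A) i), ← h1]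
    exact h0
  have hcoef := Fintype.linearIndependent_iff.1 hli (fun i => g i) hsum
  funext i
  by_cases hi : i ∈ u
  · exact hg i hi
  · exact hcoef ⟨i, hi⟩

/-- **No chain ⇒ `N(r)` invertible.** [folklore] -/
theorem det_piecewise_ne_zero_of_no_chain (A B P : Matrix n n ℝ) (u : Finset n) (hP : IsUnit P)
    (hu : ∀ i ∈ u, P i ᵥ* A = 0) (hrank : A.rank + u.card = Fintype.card n)
    (hno : ∀ v w : n → ℝ, v ᵥ* A = 0 → w ᵥ* A + v ᵥ* B = 0 → v = 0) :
    Matrix.det (u.piecewise (P * B) (P * A)) ≠ 0 := by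
  classical
  intro hdet
  obtain ⟨g, hg0, hg⟩ := Matrix.exists_vecMul_eq_zero_iff.2 hdet
  rw [vecMul_piecewise] at hg
  set gin : n → ℝ := fun i => if i ∈ u then g i else 0 with hgin
  set gout : n → ℝ := fun i => if i ∈ u then 0 else g i with hgout
  have hv : (gin ᵥ* P) ᵥ* A = 0 := vecMul_restrict_kernel A P u hu g
  have hchain := hno (gin ᵥ* P) (gout ᵥ* P) hv (by rw [add_comm]; exact hg)
  -- `gin = 0`
  have hinj := (Matrix.vecMul_injective_iff_isUnit.2 hP)
  have hgin0 : gin = 0 := hinj (by simpa using hchain)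
  -- then `gout ᵥ* P ᵥ* A = 0`, so `gout = 0`
  rw [hchain, Matrix.zero_vecMul, zero_add] at hg
  have hgout0 : gout = 0 :=
    eq_zero_of_vecMul_off A P u hP hu hrank gout (fun i hi => by simp [hgout, hi]) hg
  apply hg0
  funext i
  have h1 := congrFun hgin0 i
  have h2 := congrFun hgout0 i
  simp only [hgin, hgout, Pi.zero_apply] at h1 h2
  by_cases hi : i ∈ u
  · rw [if_pos hi] at h1; exact h1
  · rw [if_neg hi] at h2; exact h2

/-- **Chain ⇒ `N(r)` singular.** [folklore] -/
theorem det_piecewise_eq_zero_of_chain (A B P : Matrix n n ℝ) (u : Finset n) (hP : IsUnit P)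
    (hu : ∀ i ∈ u, P i ᵥ* A = 0) (hrank : A.rank + u.card = Fintype.card n)
    (v w : n → ℝ) (hv0 : v ≠ 0) (hv : v ᵥ* A = 0) (hw : w ᵥ* A + v ᵥ* B = 0) :
    Matrix.det (u.piecewise (P * B) (P * A)) = 0 := by
  classical
  have hPdet : IsUnit P.det := (Matrix.isUnit_iff_isUnit_det P).1 hP
  -- coordinates in the frame
  set c : n → ℝ := v ᵥ* P⁻¹ with hc
  set c' : n → ℝ := w ᵥ* P⁻¹ with hc'
  have hcv : c ᵥ* P = v := by rw [hc, Matrix.vecMul_vecMul, Matrix.nonsing_inv_mul P hPdet, Matrix.vecMul_one]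
  have hcw : c' ᵥ* P = w := by rw [hc', Matrix.vecMul_vecMul, Matrix.nonsing_inv_mul P hPdet, Matrix.vecMul_one]
  -- `c` is supported on `u`
  set cout : n → ℝ := fun i => if i ∈ u then 0 else c i with hcout
  have hsplit : c = (fun i => if i ∈ u then c i else 0) + cout := by
    funext i; by_cases hi : i ∈ u <;> simp [hcout, hi]
  have hcout0 : cout = 0 := by
    refine eq_zero_of_vecMul_off A P u hP hu hrank cout (fun i hi => by simp [hcout, hi]) ?_
    have h1 : (c ᵥ* P) ᵥ* A = 0 := by rw [hcv]; exact hv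
    rw [hsplit, Matrix.add_vecMul, Matrix.add_vecMul, vecMul_restrict_kernel A P u hu, zero_add] at h1
    exact h1
  have hcsupp : ∀ i, i ∉ u → c i = 0 := by
    intro i hi
    have := congrFun hcout0 i
    simpa [hcout, hi] using this
  -- the relation
  set g : n → ℝ := fun i => if i ∈ u then c i else c' i with hg
  have hgin : (fun i => if i ∈ u then g i else 0) = c := by
    funext i; by_cases hi : i ∈ u
    · simp [hg, hi]
    · simp [hi, hcsupp i hi]
  have hgout : (fun i => if i ∈ u then 0 else g i) = fun i => if i ∈ u then 0 else c' i := by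
    funext i; by_cases hi : i ∈ u <;> simp [hg, hi]
  have hwA : w ᵥ* A = ((fun i => if i ∈ u then 0 else c' i) ᵥ* P) ᵥ* A := by
    have hsplit' : c' = (fun i => if i ∈ u then c' i else 0) + fun i => if i ∈ u then 0 else c' i := by
      funext i; by_cases hi : i ∈ u <;> simp [hi]
    rw [← hcw]
    conv_lhs => rw [hsplit', Matrix.add_vecMul, Matrix.add_vecMul, vecMul_restrict_kernel A P u hu, zero_add]
  have hrel : g ᵥ* (u.piecewise (P * B) (P * A) : Matrix n n ℝ) = 0 := by
    rw [vecMul_piecewise, hgin, hgout, hcv, ← hwA, add_comm]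
    exact hw
  have hg0 : g ≠ 0 := by
    intro h
    apply hv0
    rw [← hcv]
    have : c = 0 := by
      funext i
      by_cases hi : i ∈ u
      · have := congrFun h i
        simpa [hg, hi] using this
      · exact hcsupp i hi
    rw [this, Matrix.zero_vecMul]
  exact Matrix.exists_vecMul_eq_zero_iff.1 ⟨g, hg0, hrel⟩

end Multiplicity

end Summit.ValiantsHypothesis.ValiantsHypothesis.Theorems.LacunarySymmetroidMatrixDescartes
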